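import Literature.Geometry.GeometricMeasureTheory.VarifoldLimit
import Literature.Geometry.GeometricMeasureTheory.DilationInvariance
import Mathlib.Topology.MetricSpace.ThickenedIndicator
import Mathlib.MeasureTheory.Measure.Regular
import Mathlib.Analysis.SpecificLimits.Normed
import Mathlib.Topology.MetricSpace.Sequences
import HarnessLib

/-!
# Vague convergence of locally finite measures: compactness, Portmanteau inequalities, blow-ups

Support file for the proof of the named fact
`Literature.Geometry.GeometricMeasureTheory.Federer1969_compactness_integralCurrents` along
B. White's structure-theorem-free proof of the closure theorem [White1989]: the measure-theoretic
tool behind "by [S, 4.4] there exists a subsequence `Λ'` and a Radon measure `μ` such that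
`𝓗ⁿ ⌞ η_{λ,a} M ⇀ μ`" [White1989, p. 217; Bandara2006, p. 41] — the **compactness theorem for
Radon measures** [Simon1983, Thm. 4.4] and the accompanying Portmanteau-type inequalities, for
locally finite measures on a finite-dimensional real normed space, in the vague topology (test
functions continuous with compact support).

* `Measure.VagueTendsto μs ν` — `∫ g dμ_l → ∫ g dν` for every continuous compactly supported
  `g ≥ 0` (lower integrals of `ℝ≥0`-valued functions).
* `Measure.VagueTendsto.limsup_measure_le_of_isCompact` (`limsup μ_l(F) ≤ ν(F)` for compact `F`),
  `Measure.VagueTendsto.le_liminf_measure_of_isOpen` (`ν(U) ≤ liminf μ_l(U)` for open `U`),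
  `Measure.VagueTendsto.tendsto_measure_of_null_frontier` (`μ_l(A) → ν(A)` for bounded `A` with
  `ν(∂A) = 0`), `Measure.VagueTendsto.tendsto_integral` (real-valued continuous compactly
  supported test functions) [Simon1983, §4; Mattila1995, Thm. 1.24].
* **`exists_subseq_vagueTendsto`** — **compactness**: a sequence of measures with the uniform
  polynomial growth bound `μ_l 𝐁(0, R) ≤ C (R+1)ᵖ` has a vaguely convergent subsequence with a
  locally finite limit [Simon1983, Thm. 4.4]. Proof WITHOUT a diagonal argument: the weighted
  measures `e^{-|y|} μ_l` are finite and tight, Prokhorov's theorem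
  (`exists_subseq_tendsto_of_isTightMeasureSet`) gives a weakly convergent subsequence with limit
  `ν̃`, and `ν = e^{|y|} ν̃`.
* `Measure.blowUp μ m a r = r⁻ᵐ (η_{a,r})_# μ`, `η_{a,r}(x) = r⁻¹(x - a)` — **the blow-ups of a
  measure** [White1989, p. 216], with `blowUp_apply`, `blowUp_apply_closedBall`,
  `lintegral_blowUp`, `integral_blowUp`, the growth bound `blowUp_closedBall_le_of_growth`, and
  `Measure.exists_subseq_vagueTendsto_blowUp` (blow-up sequences at a point of polynomial growth
  have vaguely convergent subsequences).

Definitions with bodies (`Measure.VagueTendsto`, `Measure.blowUp`) and theorems; no named facts.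

## References

* L. Simon, *Lectures on Geometric Measure Theory*, ANU 1983, Thm. 4.4 [Simon1983].
* P. Mattila, *Geometry of Sets and Measures in Euclidean Spaces*, CUP 1995, Thm. 1.24
  [Mattila1995].
* B. White, *A new proof of the compactness theorem for integral currents*, Comment. Math.
  Helv. 64 (1989) 207–220, pp. 216–217 [White1989].
* L. Bandara, *The closure theorem for integral currents without the structure theorem*,
  B.Sc. thesis, ANU 2006, p. 41 [Bandara2006].
-/

noncomputable section

open scoped ENNReal NNReal Topology BoundedContinuousFunction
open MeasureTheory MeasureTheory.Measure TopologicalSpace Set Filter Metric Function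

namespace Literature.Geometry.GeometricMeasureTheory

variable {V : Type*} [NormedAddCommGroup V] [NormedSpace ℝ V] [FiniteDimensional ℝ V]
  [MeasurableSpace V] [BorelSpace V]

/-! ### Vague convergence -/

section Vague

omit [FiniteDimensional ℝ V] [BorelSpace V] in
/-- **Vague convergence** of a sequence of measures: `∫ g dμ_l → ∫ g dν` for every continuous
compactly supported `g ≥ 0` (the weak-* convergence of Radon measures as functionals on
`C_c`). [cite: Simon1983, Thm. 4.4; Mattila1995, Def. 1.21] -/
def Measure.VagueTendsto (μs : ℕ → Measure V) (ν : Measure V) : Prop :=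
  ∀ g : V → ℝ≥0, Continuous g → HasCompactSupport g →
    Tendsto (fun l => ∫⁻ y, g y ∂μs l) atTop (𝓝 (∫⁻ y, g y ∂ν))

variable {μs : ℕ → Measure V} {ν : Measure V}

omit [MeasurableSpace V] [BorelSpace V] in
/-- The thickened indicator of a compact set is continuous with compact support. [folklore] -/
private theorem hasCompactSupport_thickenedIndicator {δ : ℝ} (hδ : 0 < δ) {F : Set V}
    (hF : IsCompact F) : HasCompactSupport (⇑(thickenedIndicator hδ F) : V → ℝ≥0) := by
  refine HasCompactSupport.intro (hF.cthickening (r := δ)) fun y hy => ?_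
  exact thickenedIndicator_zero hδ F fun h => hy (thickening_subset_cthickening δ F h)

/-- **Upper semicontinuity on compact sets**: `limsup μ_l(F) ≤ ν(F)` for compact `F`
(test the thickened indicators of `F` and let the thickening shrink).
[cite: Mattila1995, Thm. 1.24; Simon1983, §4] -/
theorem Measure.VagueTendsto.limsup_measure_le_of_isCompact (h : Measure.VagueTendsto μs ν)
    [IsLocallyFiniteMeasure ν] {F : Set V} (hF : IsCompact F) :
    limsup (fun l => μs l F) atTop ≤ ν F := by
  have hthick : ∀ δ : ℝ, 0 < δ → limsup (fun l => μs l F) atTop ≤ ν (cthickening δ F) := by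
    intro δ hδ
    set g : V → ℝ≥0 := ⇑(thickenedIndicator hδ F) with hg
    have hgc : Continuous g := (thickenedIndicator hδ F).continuous
    have hgs : HasCompactSupport g := hasCompactSupport_thickenedIndicator hδ hF
    have hlim := h g hgc hgs
    have h1 : ∀ l, μs l F ≤ ∫⁻ y, g y ∂μs l := fun l => by
      rw [← lintegral_indicator_one hF.measurableSet]
      refine lintegral_mono fun y => ?_
      by_cases hy : y ∈ F
      · rw [indicator_of_mem hy, hg, thickenedIndicator_one hδ F hy]; simp
      · rw [indicator_of_notMem hy]; exact zero_le
    have h2 : ∫⁻ y, g y ∂ν ≤ ν (cthickening δ F) := by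
      rw [← lintegral_indicator_one isClosed_cthickening.measurableSet]
      refine lintegral_mono fun y => ?_
      by_cases hy : y ∈ cthickening δ F
      · rw [indicator_of_mem hy, Pi.one_apply, ENNReal.coe_le_one_iff]
        exact thickenedIndicator_le_one hδ F y
      · rw [indicator_of_notMem hy, hg, thickenedIndicator_zero hδ F fun h' =>
          hy (thickening_subset_cthickening δ F h')]
        simp
    calc limsup (fun l => μs l F) atTop ≤ limsup (fun l => ∫⁻ y, g y ∂μs l) atTop :=
          limsup_le_limsup (Eventually.of_forall h1)
      _ = ∫⁻ y, g y ∂ν := hlim.limsup_eq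
      _ ≤ ν (cthickening δ F) := h2
  have hcont : Tendsto (fun r => ν (cthickening r F)) (𝓝[>] 0) (𝓝 (ν F)) :=
    (tendsto_measure_cthickening_of_isCompact hF).mono_left nhdsWithin_le_nhds
  exact ge_of_tendsto hcont (eventually_nhdsWithin_of_forall fun δ hδ => hthick δ hδ)

/-- **Lower semicontinuity on open sets**: `ν(U) ≤ liminf μ_l(U)` for open `U` (inner regularity
of `ν` and thickened indicators of compact subsets of `U`).
[cite: Mattila1995, Thm. 1.24; Simon1983, §4] -/
theorem Measure.VagueTendsto.le_liminf_measure_of_isOpen (h : Measure.VagueTendsto μs ν)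
    [IsLocallyFiniteMeasure ν] {U : Set V} (hU : IsOpen U) :
    ν U ≤ liminf (fun l => μs l U) atTop := by
  rw [hU.measure_eq_iSup_isCompact ν]
  refine iSup_le fun K => iSup_le fun hKU => iSup_le fun hK => ?_
  obtain ⟨δ, hδ, hδU⟩ := hK.exists_cthickening_subset_open hU hKU
  set g : V → ℝ≥0 := ⇑(thickenedIndicator hδ K) with hg
  have hgc : Continuous g := (thickenedIndicator hδ K).continuous
  have hgs : HasCompactSupport g := hasCompactSupport_thickenedIndicator hδ hK
  have hlim := h g hgc hgs
  have h1 : ν K ≤ ∫⁻ y, g y ∂ν := by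
    rw [← lintegral_indicator_one hK.measurableSet]
    refine lintegral_mono fun y => ?_
    by_cases hy : y ∈ K
    · rw [indicator_of_mem hy, hg, thickenedIndicator_one hδ K hy]; simp
    · rw [indicator_of_notMem hy]; exact zero_le
  have h2 : ∀ l, ∫⁻ y, g y ∂μs l ≤ μs l U := fun l => by
    rw [← lintegral_indicator_one hU.measurableSet]
    refine lintegral_mono fun y => ?_
    by_cases hy : y ∈ U
    · rw [indicator_of_mem hy, Pi.one_apply, ENNReal.coe_le_one_iff]
      exact thickenedIndicator_le_one hδ K y
    · rw [indicator_of_notMem hy, hg, thickenedIndicator_zero hδ K fun h' =>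
        hy (hδU (thickening_subset_cthickening δ K h'))]
      simp
  calc ν K ≤ ∫⁻ y, g y ∂ν := h1
    _ = liminf (fun l => ∫⁻ y, g y ∂μs l) atTop := hlim.liminf_eq.symm
    _ ≤ liminf (fun l => μs l U) atTop := liminf_le_liminf (Eventually.of_forall h2)

/-- **Continuity sets**: `μ_l(A) → ν(A)` for a bounded set `A` with `ν(∂A) = 0`.
[cite: Mattila1995, Thm. 1.24] -/
theorem Measure.VagueTendsto.tendsto_measure_of_null_frontier (h : Measure.VagueTendsto μs ν)
    [IsLocallyFiniteMeasure ν] {A : Set V} (hA : Bornology.IsBounded A) (hA0 : ν (frontier A) = 0) :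
    Tendsto (fun l => μs l A) atTop (𝓝 (ν A)) := by
  have hcl : IsCompact (closure A) := hA.isCompact_closure
  have hνcl : ν (closure A) = ν A := by
    refine le_antisymm ?_ (measure_mono subset_closure)
    calc ν (closure A) ≤ ν (A ∪ frontier A) := measure_mono fun x hx => by
          by_cases hxA : x ∈ A
          · exact Or.inl hxA
          · exact Or.inr ⟨hx, fun hi => hxA (interior_subset hi)⟩
      _ ≤ ν A + ν (frontier A) := measure_union_le _ _
      _ = ν A := by rw [hA0, add_zero]
  have hνint : ν (interior A) = ν A := by
    refine le_antisymm (measure_mono interior_subset) ?_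
    calc ν A ≤ ν (interior A ∪ frontier A) := measure_mono fun x hx => by
          by_cases hxi : x ∈ interior A
          · exact Or.inl hxi
          · exact Or.inr ⟨subset_closure hx, hxi⟩
      _ ≤ ν (interior A) + ν (frontier A) := measure_union_le _ _
      _ = ν (interior A) := by rw [hA0, add_zero]
  refine tendsto_of_le_liminf_of_limsup_le ?_ ?_
  · calc ν A = ν (interior A) := hνint.symm
      _ ≤ liminf (fun l => μs l (interior A)) atTop := h.le_liminf_measure_of_isOpen isOpen_interior
      _ ≤ liminf (fun l => μs l A) atTop :=
          liminf_le_liminf (Eventually.of_forall fun l => measure_mono interior_subset)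
  · calc limsup (fun l => μs l A) atTop ≤ limsup (fun l => μs l (closure A)) atTop :=
          limsup_le_limsup (Eventually.of_forall fun l => measure_mono subset_closure)
      _ ≤ ν (closure A) := h.limsup_measure_le_of_isCompact hcl
      _ = ν A := hνcl

omit [NormedSpace ℝ V] [FiniteDimensional ℝ V] in
/-- The real integral of a continuous compactly supported `ℝ≥0`-valued function against a measure
finite on compact sets is the (finite) lower integral. [folklore] -/
private theorem integral_coe_eq_toReal_lintegral (μ : Measure V) [IsFiniteMeasureOnCompacts μ]
    {g : V → ℝ≥0} (hg : Continuous g) (hgs : HasCompactSupport g) :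
    ∫ y, (g y : ℝ) ∂μ = (∫⁻ y, g y ∂μ).toReal ∧ ∫⁻ y, g y ∂μ ≠ ⊤ := by
  have hint : Integrable (fun y => (g y : ℝ)) μ :=
    (NNReal.continuous_coe.comp hg).integrable_of_hasCompactSupport (hgs.comp_left NNReal.coe_zero)
  refine ⟨?_, ?_⟩
  · rw [integral_eq_lintegral_of_nonneg_ae (Eventually.of_forall fun y => NNReal.coe_nonneg _)
      hint.aestronglyMeasurable]
    simp
  · have := hint.2
    simpa [HasFiniteIntegral] using this.ne

omit [NormedSpace ℝ V] [FiniteDimensional ℝ V] in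
/-- **Vague convergence for real test functions**: `∫ g dμ_l → ∫ g dν` for every continuous
compactly supported `g : V → ℝ` (split `g = g⁺ - g⁻`). [cite: Mattila1995, Def. 1.21] -/
theorem Measure.VagueTendsto.tendsto_integral (h : Measure.VagueTendsto μs ν)
    [∀ l, IsFiniteMeasureOnCompacts (μs l)] [IsFiniteMeasureOnCompacts ν] {g : V → ℝ}
    (hg : Continuous g) (hgs : HasCompactSupport g) :
    Tendsto (fun l => ∫ y, g y ∂μs l) atTop (𝓝 (∫ y, g y ∂ν)) := by
  set gp : V → ℝ≥0 := fun y => Real.toNNReal (g y) with hgp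
  set gm : V → ℝ≥0 := fun y => Real.toNNReal (-g y) with hgm
  have hgpc : Continuous gp := continuous_real_toNNReal.comp hg
  have hgmc : Continuous gm := continuous_real_toNNReal.comp hg.neg
  have hgps : HasCompactSupport gp := hgs.comp_left Real.toNNReal_zero
  have hgms : HasCompactSupport gm := hgs.comp_left (g := fun t : ℝ => Real.toNNReal (-t)) (by simp)
  have hsplit : ∀ (μ : Measure V) [IsFiniteMeasureOnCompacts μ],
      ∫ y, g y ∂μ = (∫⁻ y, gp y ∂μ).toReal - (∫⁻ y, gm y ∂μ).toReal := by
    intro μ _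
    rw [← (integral_coe_eq_toReal_lintegral μ hgpc hgps).1,
      ← (integral_coe_eq_toReal_lintegral μ hgmc hgms).1, ← integral_sub]
    · refine integral_congr_ae (Eventually.of_forall fun y => ?_)
      simp only [hgp, hgm, Real.coe_toNNReal']
      rcases le_total 0 (g y) with hy | hy
      · rw [max_eq_left hy, max_eq_right (by linarith), sub_zero]
      · rw [max_eq_right hy, max_eq_left (by linarith)]; ring
    · exact (NNReal.continuous_coe.comp hgpc).integrable_of_hasCompactSupport
        (hgps.comp_left NNReal.coe_zero)
    · exact (NNReal.continuous_coe.comp hgmc).integrable_of_hasCompactSupport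
        (hgms.comp_left NNReal.coe_zero)
  simp_rw [hsplit]
  refine Tendsto.sub ?_ ?_
  · exact (ENNReal.tendsto_toReal (integral_coe_eq_toReal_lintegral ν hgpc hgps).2).comp
      (h gp hgpc hgps)
  · exact (ENNReal.tendsto_toReal (integral_coe_eq_toReal_lintegral ν hgmc hgms).2).comp
      (h gm hgmc hgms)

end Vague

/-! ### Compactness -/

section Compactness

omit [NormedSpace ℝ V] [FiniteDimensional ℝ V] [MeasurableSpace V] [BorelSpace V] in
/-- Shell bound for the exponential weight: `e^{-|y|} 1_{|y| > N} ≤ Σᵢ e^{-(i+N)} 1_{𝐁(0, i+N+1)}(y)`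
(take `i = ⌊|y|⌋ - N`). [folklore] -/
private theorem exp_weight_le_tsum (N : ℕ) (y : V) (hy : (N : ℝ) ≤ ‖y‖) :
    ENNReal.ofReal (Real.exp (-‖y‖)) ≤
      ∑' i : ℕ, ENNReal.ofReal (Real.exp (-((i : ℝ) + N))) *
        (closedBall (0 : V) ((i : ℝ) + N + 1)).indicator 1 y := by
  set j := ⌊‖y‖⌋₊ with hj
  have hj1 : (j : ℝ) ≤ ‖y‖ := Nat.floor_le (norm_nonneg y)
  have hj2 : ‖y‖ < j + 1 := Nat.lt_floor_add_one ‖y‖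
  have hNj : N ≤ j := Nat.le_floor hy
  refine le_trans ?_ (ENNReal.le_tsum (j - N))
  have hcast : ((j - N : ℕ) : ℝ) + N = j := by
    rw [Nat.cast_sub hNj]; ring
  rw [hcast, indicator_of_mem (by rw [mem_closedBall, dist_zero_right]; exact hj2.le), Pi.one_apply,
    mul_one]
  exact ENNReal.ofReal_le_ofReal (Real.exp_le_exp.2 (by linarith))

omit [NormedSpace ℝ V] [FiniteDimensional ℝ V] in
/-- Integrating the shell bound: `∫_S e^{-|y|} dμ ≤ Σᵢ e^{-(i+N)} μ 𝐁(0, i+N+1)` if `|y| ≥ N` on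
`S`. [folklore] -/
private theorem lintegral_exp_weight_le (μ : Measure V) (N : ℕ) {S : Set V}
    (hS : ∀ y ∈ S, (N : ℝ) ≤ ‖y‖) (hSm : MeasurableSet S) :
    ∫⁻ y in S, ENNReal.ofReal (Real.exp (-‖y‖)) ∂μ ≤
      ∑' i : ℕ, ENNReal.ofReal (Real.exp (-((i : ℝ) + N))) * μ (closedBall (0 : V) ((i : ℝ) + N + 1)) := by
  have hmeas : ∀ i : ℕ, Measurable fun y : V => ENNReal.ofReal (Real.exp (-((i : ℝ) + N))) *
      (closedBall (0 : V) ((i : ℝ) + N + 1)).indicator 1 y := fun i =>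
    measurable_const.mul (measurable_one.indicator measurableSet_closedBall)
  calc ∫⁻ y in S, ENNReal.ofReal (Real.exp (-‖y‖)) ∂μ
      ≤ ∫⁻ y in S, ∑' i : ℕ, ENNReal.ofReal (Real.exp (-((i : ℝ) + N))) *
          (closedBall (0 : V) ((i : ℝ) + N + 1)).indicator 1 y ∂μ :=
        setLIntegral_mono' hSm fun y hy => exp_weight_le_tsum N y (hS y hy)
    _ ≤ ∫⁻ y, ∑' i : ℕ, ENNReal.ofReal (Real.exp (-((i : ℝ) + N))) *
          (closedBall (0 : V) ((i : ℝ) + N + 1)).indicator 1 y ∂μ := setLIntegral_le_lintegral _ _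
    _ = ∑' i : ℕ, ∫⁻ y, ENNReal.ofReal (Real.exp (-((i : ℝ) + N))) *
          (closedBall (0 : V) ((i : ℝ) + N + 1)).indicator 1 y ∂μ :=
        lintegral_tsum fun i => (hmeas i).aemeasurable
    _ = ∑' i : ℕ, ENNReal.ofReal (Real.exp (-((i : ℝ) + N))) * μ (closedBall (0 : V) ((i : ℝ) + N + 1)) := by
        refine tsum_congr fun i => ?_
        rw [lintegral_const_mul _ (measurable_one.indicator measurableSet_closedBall),
          lintegral_indicator_one measurableSet_closedBall]

/-- The summable majorant `Σⱼ e^{-j} (j + q)ᵖ < ∞`. [folklore] -/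
private theorem tsum_exp_mul_pow_ne_top (p : ℕ) (q : ℝ) (hq : 0 ≤ q) :
    ∑' j : ℕ, ENNReal.ofReal (Real.exp (-(j : ℝ)) * ((j : ℝ) + q) ^ p) ≠ ⊤ := by
  -- `(j + q)^p ≤ 2^p (j^p + q^p)` would do; we use `(j+q)^p ≤ (⌈q⌉ + 1)^p (j + 1)^p` via monotonicity
  set Q : ℕ := ⌈q⌉₊ with hQ
  have hq' : q ≤ Q := Nat.le_ceil q
  have hsum : Summable fun j : ℕ => Real.exp (-(j : ℝ)) * (((j : ℝ) + Q + 1) ^ p) := by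
    have h0 := Real.summable_pow_mul_exp_neg_nat_mul p one_pos
    have h1 := (summable_nat_add_iff (Q + 1)).2 h0
    have h2 := h1.mul_left (Real.exp ((Q : ℝ) + 1))
    refine h2.congr fun j => ?_
    simp only [neg_mul, one_mul, Nat.cast_add, Nat.cast_one]
    rw [show Real.exp (-((j : ℝ) + (Q + 1))) = Real.exp (-(j : ℝ)) * Real.exp (-((Q : ℝ) + 1)) by
      rw [← Real.exp_add]; ring_nf]
    have : Real.exp ((Q : ℝ) + 1) * Real.exp (-((Q : ℝ) + 1)) = 1 := by
      rw [← Real.exp_add, add_neg_cancel, Real.exp_zero]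
    calc Real.exp ((Q : ℝ) + 1) * (((j : ℝ) + (Q + 1)) ^ p * (Real.exp (-(j : ℝ)) * Real.exp (-((Q : ℝ) + 1))))
        = (Real.exp ((Q : ℝ) + 1) * Real.exp (-((Q : ℝ) + 1))) * (Real.exp (-(j : ℝ)) *
            ((j : ℝ) + Q + 1) ^ p) := by ring
      _ = _ := by rw [this, one_mul]
  have hle : ∀ j : ℕ, Real.exp (-(j : ℝ)) * ((j : ℝ) + q) ^ p ≤
      Real.exp (-(j : ℝ)) * (((j : ℝ) + Q + 1) ^ p) := fun j =>
    mul_le_mul_of_nonneg_left (pow_le_pow_left₀ (by positivity) (by linarith) p) (Real.exp_nonneg _)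
  rw [← ENNReal.ofReal_tsum_of_nonneg (fun j => by positivity) (hsum.of_nonneg_of_le
    (fun j => by positivity) hle)]
  exact ENNReal.ofReal_ne_top

/-- **Compactness theorem for Radon measures in the vague topology** [Simon1983, Thm. 4.4;
White1989, p. 217: "Thus [S, 4.4] there exists a subsequence `Λ'` and a Radon measure `μ` such
that `𝓗ⁿ ⌞ η_{λ,a} M ⇀ μ`"]: a sequence of measures on a finite-dimensional space with the uniform
growth bound `μ_l 𝐁(0, R) ≤ C (R + 1)ᵖ` has a subsequence converging vaguely to a locally finite
measure. Proof without a diagonal argument: the weighted measures `e^{-|y|} μ_l` are finite,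
uniformly bounded and tight; Prokhorov's theorem gives a weakly convergent subsequence with
limit `ν̃`, and `ν = e^{|y|} ν̃`. [cite: Simon1983, Thm. 4.4] -/
theorem exists_subseq_vagueTendsto (μs : ℕ → Measure V) {C : ℝ≥0∞} (hC : C ≠ ⊤) {p : ℕ}
    (hbd : ∀ l (R : ℝ), 0 ≤ R → μs l (closedBall 0 R) ≤ C * ENNReal.ofReal ((R + 1) ^ p)) :
    ∃ (ι : ℕ → ℕ) (ν : Measure V), StrictMono ι ∧ IsLocallyFiniteMeasure ν ∧
      Measure.VagueTendsto (μs ∘ ι) ν := by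
  classical
  -- the weight
  set W : V → ℝ≥0∞ := fun y => ENNReal.ofReal (Real.exp (-‖y‖)) with hW
  have hWc : Continuous W := ENNReal.continuous_ofReal.comp (Real.continuous_exp.comp continuous_norm.neg)
  have hWm : Measurable W := hWc.measurable
  -- the majorant
  set a : ℕ → ℕ → ℝ≥0∞ := fun N i =>
    ENNReal.ofReal (Real.exp (-((i : ℝ) + N))) * (C * ENNReal.ofReal (((i : ℝ) + N + 1 + 1) ^ p)) with ha
  have hshell : ∀ (l N : ℕ), ∫⁻ y in (closedBall (0 : V) N)ᶜ, W y ∂μs l ≤ ∑' i, a N i := by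
    intro l N
    refine (lintegral_exp_weight_le (μs l) N (fun y hy => ?_)
      isClosed_closedBall.measurableSet.compl).trans (ENNReal.tsum_le_tsum fun i => ?_)
    · rw [mem_compl_iff, mem_closedBall, dist_zero_right, not_le] at hy
      exact hy.le
    · exact mul_le_mul' le_rfl (hbd l _ (by positivity))
  -- `Σ_i a N i = e^{-N}-shifted tail of a convergent series`
  set b : ℕ → ℝ≥0∞ := fun j => ENNReal.ofReal (Real.exp (-(j : ℝ)) * ((j : ℝ) + 2) ^ p) with hb
  have hb_top : ∑' j, b j ≠ ⊤ := tsum_exp_mul_pow_ne_top p 2 (by norm_num)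
  have hab : ∀ N i, a N i = C * b (i + N) := by
    intro N i
    rw [ha, hb]
    simp only [Nat.cast_add]
    rw [ENNReal.ofReal_mul (Real.exp_nonneg _), show (i : ℝ) + N + 1 + 1 = (i : ℝ) + N + 2 by ring]
    ring
  have htail : Tendsto (fun N : ℕ => ∑' i, a N i) atTop (𝓝 0) := by
    have h := ENNReal.tendsto_sum_nat_add b hb_top
    have h2 : Tendsto (fun N : ℕ => C * ∑' i, b (i + N)) atTop (𝓝 (C * 0)) :=
      ENNReal.Tendsto.const_mul h (Or.inr hC)
    rw [mul_zero] at h2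
    refine h2.congr fun N => ?_
    rw [← ENNReal.tsum_mul_left]
    exact tsum_congr fun i => (hab N i).symm
  -- total masses
  have hmass : ∀ l, ∫⁻ y, W y ∂μs l ≤ ∑' i, a 0 i := by
    intro l
    have h := lintegral_exp_weight_le (μs l) 0 (S := univ) (fun y _ => by simp) MeasurableSet.univ
    rw [Measure.restrict_univ] at h
    refine h.trans (ENNReal.tsum_le_tsum fun i => ?_)
    exact mul_le_mul' le_rfl (hbd l _ (by positivity))
  have hmass' : ∀ l, ∫⁻ y, W y ∂μs l ≤ C * ∑' j, b j := fun l =>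
    (hmass l).trans (by
      rw [← ENNReal.tsum_mul_left]
      refine ENNReal.tsum_le_tsum fun i => ?_
      rw [hab 0 i, add_zero])
  have htop : C * ∑' j, b j ≠ ⊤ := ENNReal.mul_ne_top hC hb_top
  -- the weighted finite measures
  set μt : ℕ → Measure V := fun l => (μs l).withDensity W with hμt
  have hμt_univ : ∀ l, μt l univ = ∫⁻ y, W y ∂μs l := fun l => by
    rw [hμt, withDensity_apply _ MeasurableSet.univ, Measure.restrict_univ]
  haveI hfin : ∀ l, IsFiniteMeasure (μt l) := fun l =>
    ⟨by rw [hμt_univ]; exact (hmass' l).trans_lt htop.lt_top⟩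
  set νt : ℕ → FiniteMeasure V := fun l => ⟨μt l, hfin l⟩ with hνt
  have hνt_coe : ∀ l, ((νt l : FiniteMeasure V) : Measure V) = μt l := fun l => rfl
  -- tightness
  have htight : IsTightMeasureSet (Set.range fun l => ((νt l : FiniteMeasure V) : Measure V)) := by
    rw [isTightMeasureSet_iff_exists_isCompact_measure_compl_le]
    intro ε hε
    obtain ⟨N, hN⟩ := (htail.eventually (ge_mem_nhds hε)).exists
    refine ⟨closedBall 0 N, isCompact_closedBall _ _, ?_⟩
    rintro _ ⟨l, rfl⟩
    show ((νt l : FiniteMeasure V) : Measure V) (closedBall 0 (N : ℝ))ᶜ ≤ ε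
    rw [hνt_coe, hμt, withDensity_apply _ isClosed_closedBall.measurableSet.compl]
    exact (hshell l N).trans hN
  -- masses: a convergent subsequence
  have hbdd : ∀ l, (νt l).mass ∈ Set.Icc (0 : ℝ≥0) (C * ∑' j, b j).toNNReal := fun l => by
    refine ⟨bot_le, ?_⟩
    rw [← ENNReal.coe_le_coe, FiniteMeasure.ennreal_mass, hνt_coe, hμt_univ, ENNReal.coe_toNNReal htop]
    exact hmass' l
  obtain ⟨M, -, ι₁, hι₁, hM⟩ := tendsto_subseq_of_bounded (Metric.isBounded_Icc (0 : ℝ≥0) _) hbdd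
  -- comparison `g ≤ K W` for a test function `g`
  have hdom : ∀ g : V → ℝ≥0, Continuous g → HasCompactSupport g →
      ∃ K : ℝ≥0∞, K ≠ ⊤ ∧ ∀ y, (g y : ℝ≥0∞) ≤ K * W y := by
    intro g hg hgs
    obtain ⟨R, hR⟩ := hgs.isCompact.isBounded.subset_closedBall 0
    obtain ⟨B, hB⟩ := (hgs.isCompact_range hg).bddAbove
    refine ⟨(B : ℝ≥0∞) * ENNReal.ofReal (Real.exp R), ENNReal.mul_ne_top ENNReal.coe_ne_top
      ENNReal.ofReal_ne_top, fun y => ?_⟩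
    by_cases hy : y ∈ tsupport g
    · have hyR : ‖y‖ ≤ R := by
        have := hR hy; rwa [mem_closedBall, dist_zero_right] at this
      have hWy : 1 ≤ ENNReal.ofReal (Real.exp R) * W y := by
        rw [hW, ← ENNReal.ofReal_mul (Real.exp_nonneg _), ← Real.exp_add, ← ENNReal.ofReal_one]
        exact ENNReal.ofReal_le_ofReal (Real.one_le_exp (by linarith))
      calc (g y : ℝ≥0∞) ≤ B := ENNReal.coe_le_coe.2 (hB ⟨y, rfl⟩)
        _ ≤ B * (ENNReal.ofReal (Real.exp R) * W y) := le_mul_of_one_le_right' hWy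
        _ = B * ENNReal.ofReal (Real.exp R) * W y := (mul_assoc _ _ _).symm
    · rw [image_eq_zero_of_notMem_tsupport hy]
      simp
  by_cases hM0 : M = 0
  · -- vanishing mass: the vague limit is `0`
    refine ⟨ι₁, 0, hι₁, inferInstance, fun g hg hgs => ?_⟩
    obtain ⟨K, hK, hgK⟩ := hdom g hg hgs
    have hmass0 : Tendsto (fun j => μt (ι₁ j) univ) atTop (𝓝 0) := by
      have h := ENNReal.tendsto_coe.2 hM
      rw [hM0, ENNReal.coe_zero] at h
      refine h.congr fun j => ?_
      show ((νt (ι₁ j)).mass : ℝ≥0∞) = μt (ι₁ j) univ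
      rw [FiniteMeasure.ennreal_mass, hνt_coe]
    have hK0 : Tendsto (fun j => K * μt (ι₁ j) univ) atTop (𝓝 0) := by
      have := ENNReal.Tendsto.const_mul hmass0 (Or.inr hK)
      rwa [mul_zero] at this
    rw [lintegral_zero_measure]
    refine tendsto_of_tendsto_of_tendsto_of_le_of_le tendsto_const_nhds hK0 (fun j => zero_le)
      fun j => ?_
    calc ∫⁻ y, (g y : ℝ≥0∞) ∂(μs ∘ ι₁) j ≤ ∫⁻ y, K * W y ∂μs (ι₁ j) := lintegral_mono hgK
      _ = K * ∫⁻ y, W y ∂μs (ι₁ j) := lintegral_const_mul _ hWm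
      _ = K * μt (ι₁ j) univ := by rw [hμt_univ]
  · -- positive mass: Prokhorov
    have hMpos : 0 < M := pos_iff_ne_zero.2 hM0
    obtain ⟨ι₂, hι₂, νt', -, hlim⟩ := exists_subseq_tendsto_of_isTightMeasureSet (fun j => νt (ι₁ j))
      (htight.subset (by rintro _ ⟨j, rfl⟩; exact ⟨ι₁ j, rfl⟩)) hMpos hM
    set Winv : V → ℝ≥0∞ := fun y => ENNReal.ofReal (Real.exp ‖y‖) with hWinv
    have hWinvc : Continuous Winv := ENNReal.continuous_ofReal.comp (Real.continuous_exp.comp continuous_norm)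
    have hWinvm : Measurable Winv := hWinvc.measurable
    set ν : Measure V := (νt' : Measure V).withDensity Winv with hν
    have hWW : ∀ y, W y * Winv y = 1 := fun y => by
      rw [hW, hWinv, ← ENNReal.ofReal_mul (Real.exp_nonneg _), ← Real.exp_add, neg_add_cancel,
        Real.exp_zero, ENNReal.ofReal_one]
    refine ⟨ι₁ ∘ ι₂, ν, hι₁.comp hι₂, ?_, fun g hg hgs => ?_⟩
    · -- `ν` is locally finite
      refine ⟨fun x => ⟨closedBall 0 (‖x‖ + 1), ?_, ?_⟩⟩
      · refine mem_of_superset (ball_mem_nhds x one_pos) fun y hy => ?_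
        rw [mem_closedBall, dist_zero_right]
        rw [mem_ball] at hy
        calc ‖y‖ = dist y 0 := (dist_zero_right y).symm
          _ ≤ dist y x + dist x 0 := dist_triangle _ _ _
          _ ≤ 1 + ‖x‖ := by rw [dist_zero_right]; exact add_le_add hy.le le_rfl
          _ = ‖x‖ + 1 := add_comm _ _
      · rw [hν, withDensity_apply _ measurableSet_closedBall]
        calc ∫⁻ y in closedBall 0 (‖x‖ + 1), Winv y ∂(νt' : Measure V)
            ≤ ∫⁻ y in closedBall 0 (‖x‖ + 1), ENNReal.ofReal (Real.exp (‖x‖ + 1)) ∂(νt' : Measure V) := by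
              refine setLIntegral_mono' measurableSet_closedBall fun y hy => ?_
              rw [mem_closedBall, dist_zero_right] at hy
              exact ENNReal.ofReal_le_ofReal (Real.exp_le_exp.2 hy)
          _ = ENNReal.ofReal (Real.exp (‖x‖ + 1)) * (νt' : Measure V) (closedBall 0 (‖x‖ + 1)) :=
              setLIntegral_const _ _
          _ < ⊤ := ENNReal.mul_lt_top ENNReal.ofReal_lt_top (measure_lt_top _ _)
    · -- vague convergence
      obtain ⟨R, hR⟩ := hgs.isCompact.isBounded.subset_closedBall 0
      obtain ⟨B, hB⟩ := (hgs.isCompact_range hg).bddAbove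
      set hf : V → ℝ≥0 := fun y => g y * (Real.exp ‖y‖).toNNReal with hhf
      have hhc : Continuous hf := hg.mul (continuous_real_toNNReal.comp (Real.continuous_exp.comp continuous_norm))
      have hbound : ∀ y, (hf y : ℝ) ≤ B * Real.exp R := by
        intro y
        show ((g y * (Real.exp ‖y‖).toNNReal : ℝ≥0) : ℝ) ≤ B * Real.exp R
        by_cases hy : y ∈ tsupport g
        · have hyR : ‖y‖ ≤ R := by
            have := hR hy; rwa [mem_closedBall, dist_zero_right] at this
          rw [NNReal.coe_mul, Real.coe_toNNReal _ (Real.exp_nonneg _)]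
          exact mul_le_mul (hB ⟨y, rfl⟩) (Real.exp_le_exp.2 hyR) (Real.exp_nonneg _) B.2
        · rw [image_eq_zero_of_notMem_tsupport hy, zero_mul, NNReal.coe_zero]
          positivity
      set hb : V →ᵇ ℝ≥0 := BoundedContinuousFunction.mkOfBound ⟨hf, hhc⟩ (B * Real.exp R + B * Real.exp R)
        (fun x y => by
          rw [NNReal.dist_eq, ContinuousMap.coe_mk]
          have hx := hbound x; have hy := hbound y
          have hx0 : (0 : ℝ) ≤ hf x := (hf x).2
          have hy0 : (0 : ℝ) ≤ hf y := (hf y).2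
          rw [abs_le]; constructor <;> linarith) with hhb
      have hhb_apply : ∀ y, hb y = hf y := fun y => rfl
      have hconv := (FiniteMeasure.tendsto_iff_forall_lintegral_tendsto.1 hlim) hb
      -- identify both sides
      have hlhs : ∀ l, ∫⁻ y, (hb y : ℝ≥0∞) ∂((νt l : FiniteMeasure V) : Measure V) = ∫⁻ y, (g y : ℝ≥0∞) ∂μs l := by
        intro l
        show ∫⁻ y, (hb y : ℝ≥0∞) ∂((μs l).withDensity W) = _
        rw [lintegral_withDensity_eq_lintegral_mul _ hWm
          (show Measurable (fun y => (hb y : ℝ≥0∞)) from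
            measurable_coe_nnreal_ennreal.comp hhc.measurable)]
        refine lintegral_congr fun y => ?_
        rw [Pi.mul_apply, hhb_apply, hhf, ENNReal.coe_mul, show ((Real.exp ‖y‖).toNNReal : ℝ≥0∞) = Winv y from rfl,
          mul_comm (g y : ℝ≥0∞), ← mul_assoc, hWW, one_mul]
      have hrhs : ∫⁻ y, (hb y : ℝ≥0∞) ∂(νt' : Measure V) = ∫⁻ y, (g y : ℝ≥0∞) ∂ν := by
        show _ = ∫⁻ y, (g y : ℝ≥0∞) ∂((νt' : Measure V).withDensity Winv)
        rw [lintegral_withDensity_eq_lintegral_mul _ hWinvm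
          (show Measurable (fun y => (g y : ℝ≥0∞)) from
            measurable_coe_nnreal_ennreal.comp hg.measurable)]
        refine lintegral_congr fun y => ?_
        rw [Pi.mul_apply, hhb_apply, hhf, ENNReal.coe_mul, show ((Real.exp ‖y‖).toNNReal : ℝ≥0∞) = Winv y from rfl,
          mul_comm]
      rw [hrhs] at hconv
      refine hconv.congr fun j => ?_
      simp only [Function.comp_apply]
      exact hlhs _

end Compactness


/-! ### Blow-ups of a measure -/

section BlowUp

variable {m : ℕ}

omit [FiniteDimensional ℝ V] [BorelSpace V] in
/-- **The blow-up `μ_{a,r} = r⁻ᵐ (η_{a,r})_# μ`** of a measure at `a` with scale `r`, where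
`η_{a,r}(x) = r⁻¹ (x - a)`: `μ_{a,r}(E) = r⁻ᵐ μ(a + r E)`. [cite: White1989, p. 216] -/
def Measure.blowUp (μ : Measure V) (m : ℕ) (a : V) (r : ℝ) : Measure V :=
  ENNReal.ofReal ((r⁻¹) ^ m) • μ.map (fun x => r⁻¹ • (x - a))

omit [FiniteDimensional ℝ V] in
/-- `η_{a,r}` is a measurable embedding (a homeomorphism). [folklore] -/
private theorem measurableEmbedding_dilate (a : V) {r : ℝ} (hr : 0 < r) :
    MeasurableEmbedding fun x : V => r⁻¹ • (x - a) := by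
  set e : V ≃ₜ V := (Homeomorph.addRight (-a)).trans
    (Homeomorph.smulOfNeZero r⁻¹ (inv_ne_zero hr.ne')) with he
  have hfun : (fun x : V => r⁻¹ • (x - a)) = e := by
    funext x; simp [he, sub_eq_add_neg]
  rw [hfun]
  exact e.measurableEmbedding

omit [FiniteDimensional ℝ V] [MeasurableSpace V] [BorelSpace V] in
/-- `η_{a,r}⁻¹(E) = a + r E`. [folklore] -/
private theorem preimage_dilate_eq_image (a : V) {r : ℝ} (hr : 0 < r) (E : Set V) :
    (fun x : V => r⁻¹ • (x - a)) ⁻¹' E = (fun y : V => a + r • y) '' E := by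
  ext x
  constructor
  · intro hx
    refine ⟨r⁻¹ • (x - a), hx, ?_⟩
    show a + r • (r⁻¹ • (x - a)) = x
    rw [smul_smul, mul_inv_cancel₀ hr.ne', one_smul, add_sub_cancel]
  · rintro ⟨y, hy, rfl⟩
    simpa [smul_smul, inv_mul_cancel₀ hr.ne'] using hy

omit [FiniteDimensional ℝ V] in
/-- `μ_{a,r}(E) = r⁻ᵐ μ(a + r E)`. [cite: White1989, p. 216] -/
theorem Measure.blowUp_apply (μ : Measure V) (m : ℕ) (a : V) {r : ℝ} (hr : 0 < r) (E : Set V) :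
    Measure.blowUp μ m a r E = ENNReal.ofReal ((r⁻¹) ^ m) * μ ((fun y : V => a + r • y) '' E) := by
  rw [Measure.blowUp, Measure.smul_apply, smul_eq_mul, (measurableEmbedding_dilate a hr).map_apply,
    preimage_dilate_eq_image a hr]

omit [FiniteDimensional ℝ V] in
/-- `μ_{a,r}(𝐁(y, s)) = r⁻ᵐ μ(𝐁(a + r y, r s))`. [cite: White1989, p. 216] -/
theorem Measure.blowUp_apply_closedBall (μ : Measure V) (m : ℕ) (a : V) {r : ℝ} (hr : 0 < r)
    (y : V) (s : ℝ) :
    Measure.blowUp μ m a r (closedBall y s) = ENNReal.ofReal ((r⁻¹) ^ m) * μ (closedBall (a + r • y) (r * s)) := by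
  rw [Measure.blowUp_apply μ m a hr, image_add_smul_closedBall a y hr]

omit [FiniteDimensional ℝ V] in
/-- `∫ g dμ_{a,r} = r⁻ᵐ ∫ g(η_{a,r} x) dμ(x)` (lower integrals). [cite: White1989, p. 216] -/
theorem Measure.lintegral_blowUp (μ : Measure V) (m : ℕ) (a : V) {r : ℝ} (hr : 0 < r)
    (g : V → ℝ≥0∞) :
    ∫⁻ y, g y ∂(Measure.blowUp μ m a r) = ENNReal.ofReal ((r⁻¹) ^ m) * ∫⁻ x, g (r⁻¹ • (x - a)) ∂μ := by
  rw [Measure.blowUp, lintegral_smul_measure, (measurableEmbedding_dilate a hr).lintegral_map,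
    smul_eq_mul]

omit [FiniteDimensional ℝ V] in
/-- `∫ g dμ_{a,r} = r⁻ᵐ ∫ g(η_{a,r} x) dμ(x)` (Bochner integrals). [cite: White1989, p. 216] -/
theorem Measure.integral_blowUp {E : Type*} [NormedAddCommGroup E] [NormedSpace ℝ E]
    (μ : Measure V) (m : ℕ) (a : V) {r : ℝ} (hr : 0 < r) (g : V → E) :
    ∫ y, g y ∂(Measure.blowUp μ m a r) = ((r⁻¹) ^ m) • ∫ x, g (r⁻¹ • (x - a)) ∂μ := by
  rw [Measure.blowUp, integral_smul_measure, (measurableEmbedding_dilate a hr).integral_map,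
    ENNReal.toReal_ofReal (by positivity)]

omit [FiniteDimensional ℝ V] in
/-- The blow-up of a finite measure is finite. [cite: White1989, p. 216] -/
theorem Measure.isFiniteMeasure_blowUp (μ : Measure V) [IsFiniteMeasure μ] (m : ℕ) (a : V) {r : ℝ}
    (hr : 0 < r) : IsFiniteMeasure (Measure.blowUp μ m a r) :=
  ⟨by rw [Measure.blowUp_apply μ m a hr]; exact ENNReal.mul_lt_top ENNReal.ofReal_lt_top (measure_lt_top _ _)⟩

omit [FiniteDimensional ℝ V] in
/-- **Growth transfers to blow-ups**: if `μ 𝐁(a, s) ≤ K sᵐ` for all `s > 0` then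
`μ_{a,r} 𝐁(0, R) ≤ K Rᵐ` for all `R > 0`. [cite: White1989, p. 217] -/
theorem Measure.blowUp_closedBall_le_of_growth (μ : Measure V) {m : ℕ} {a : V} {K : ℝ≥0∞}
    (hK : ∀ s : ℝ, 0 < s → μ (closedBall a s) ≤ K * ENNReal.ofReal (s ^ m)) {r : ℝ} (hr : 0 < r)
    {R : ℝ} (hR : 0 < R) :
    Measure.blowUp μ m a r (closedBall 0 R) ≤ K * ENNReal.ofReal (R ^ m) := by
  rw [Measure.blowUp_apply_closedBall μ m a hr, smul_zero, add_zero]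
  calc ENNReal.ofReal ((r⁻¹) ^ m) * μ (closedBall a (r * R))
      ≤ ENNReal.ofReal ((r⁻¹) ^ m) * (K * ENNReal.ofReal ((r * R) ^ m)) :=
        mul_le_mul' le_rfl (hK _ (by positivity))
    _ = K * ENNReal.ofReal ((r⁻¹) ^ m * (r * R) ^ m) := by
        rw [ENNReal.ofReal_mul (by positivity)]; ring
    _ = K * ENNReal.ofReal (R ^ m) := by
        rw [mul_pow, ← mul_assoc, ← mul_pow, inv_mul_cancel₀ hr.ne', one_pow, one_mul]

/-- **Blow-up sequences have vaguely convergent subsequences**: if `μ 𝐁(a, s) ≤ K sᵐ` for all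
`s > 0` (`K < ∞`), every sequence of scales `r_l > 0` has a subsequence along which the
blow-ups `μ_{a, r_l}` converge vaguely to a locally finite measure. [cite: White1989, p. 217] -/
theorem Measure.exists_subseq_vagueTendsto_blowUp (μ : Measure V) {m : ℕ} {a : V} {K : ℝ≥0∞}
    (hK : K ≠ ⊤) (hgrowth : ∀ s : ℝ, 0 < s → μ (closedBall a s) ≤ K * ENNReal.ofReal (s ^ m))
    {r : ℕ → ℝ} (hr : ∀ l, 0 < r l) :
    ∃ (ι : ℕ → ℕ) (ν : Measure V), StrictMono ι ∧ IsLocallyFiniteMeasure ν ∧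
      Measure.VagueTendsto (fun l => Measure.blowUp μ m a (r (ι l))) ν := by
  refine exists_subseq_vagueTendsto (fun l => Measure.blowUp μ m a (r l)) hK (p := m) fun l R hR => ?_
  calc Measure.blowUp μ m a (r l) (closedBall 0 R) ≤ Measure.blowUp μ m a (r l) (closedBall 0 (R + 1)) :=
        measure_mono (closedBall_subset_closedBall (by linarith))
    _ ≤ K * ENNReal.ofReal ((R + 1) ^ m) := Measure.blowUp_closedBall_le_of_growth μ hgrowth (hr l) (by linarith)

end BlowUp

end Literature.Geometry.GeometricMeasureTheory
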